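import Summits.MatrixMultiplication.OmegaCensus.DihedralLawModOneCubePairCyclic
import Summits.MatrixMultiplication.OmegaCensus.DihedralLawModOneNonCube
import Summits.MatrixMultiplication.OmegaCensus.DihedralLawModOneSmallExponent
import HarnessLib

/-!
# The `|A| ≡ 1 (mod 3)` law needs an element of order `≥ |A|/2`: sets of size 4, `|A| = 25`, `|A| = 6p+1`

ω-census, family (b3).  Framing: lottery ticket; floor = certified bounds/negative ranges.

Classification conjecture (FAMILY-B.md): a dihedral-like group over `A` with `|A| ≡ 1 (mod 3)` attains the law
`3|S||T||U| + 8 = 8|A|` iff `A` has an element of order `≥ |A|/2`.  Proved pieces assembled here: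
* `card_le_two_mul_addOrderOf_of_mod_one_law_card_four`: a law triple with `|T| = 4` (`|A| ≥ 14`) forces
  `|A| ≤ 2·ord(g)` for some `g` — non-cube shapes give two cosets of a cyclic group
  (`two_cosets_of_mod_one_law_of_not_cube`), cube shapes have `T`-parts `(2,2)` and force `A` cyclic
  (`cyclic_of_law_cube_two_pair`);
* **`card_le_two_mul_addOrderOf_of_law_card_25`**: at `|A| = 25` EVERY law triple forces `|A| ≤ 2·ord(g)`, i.e.
  `A ≅ ℤ₂₅` (cube shapes there are `(1,1,8)`, `(1,2,4)`, `(2,2,2)` up to order: two sets of size 2, or a set of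
  size 4); hence (**`no_law_card_25_of_small_orders`**) dihedral-like groups of order 50 over `ℤ₅ × ℤ₅` do not
  attain `64` — the census datum `β(Dih(ℤ₅²)) < 64` (gen 3) as a theorem;
* `card_le_two_mul_addOrderOf_of_law_card_six_prime_add_one`, `no_law_card_six_prime_add_one_of_small_orders`:
  the same at every `|A| = 6p + 1`, `p ≥ 3` prime (cube shapes `s₀t₀u₀ = 2p`: a part `2` or two parts `1`), so
  the classification 'law ⟹ an element of order ≥ |A|/2' holds at `|A| ∈ {25} ∪ {3p+1} ∪ {6p+1}`.
-/

namespace Summit.MatrixMultiplication.OmegaCensus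

open Literature.Combinatorics.Additive Finset

section DihedralLike

variable {A : Type*} [AddCommGroup A] [DecidableEq A] [Fintype A] {G : Type} [Group G] [DecidableEq G]
  {ρ τ : A → G} {c₀ : A} {S T U : Finset G}

omit [DecidableEq A] in
/-- A generator has order `|A|`. [folklore] -/
theorem card_eq_addOrderOf_of_zmultiples_eq_top {g : A} (hg : AddSubgroup.zmultiples g = ⊤) :
    Fintype.card A = addOrderOf g := by
  classical
  rw [← card_filter_sub_mem_zmultiples g 0]
  rw [filter_true_of_mem fun y _ => by rw [hg]; exact AddSubgroup.mem_top (y - 0), card_univ]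

/-- **A law triple with a set of size 4 forces an element of order `≥ |A|/2`.** [folklore] -/
theorem card_le_two_mul_addOrderOf_of_mod_one_law_card_four
    (hρρ : ∀ a b, ρ a * ρ b = ρ (a + b)) (hρτ : ∀ a b, ρ a * τ b = τ (b - a))
    (hτρ : ∀ a b, τ a * ρ b = τ (a + b)) (hττ : ∀ a b, τ a * τ b = ρ (c₀ + b - a))
    (hρ : Function.Injective ρ) (hτ : Function.Injective τ) (hne : ∀ a b, ρ a ≠ τ b)
    (hsurj : ∀ g, (∃ a, ρ a = g) ∨ (∃ a, τ a = g)) (hmod : Fintype.card A % 3 = 1) (hA : 14 ≤ Fintype.card A)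
    (h : TripleProductProperty S T U) (hV : 3 * (S.card * T.card * U.card) + 8 = 8 * Fintype.card A)
    (hT : T.card = 4) :
    ∃ g : A, Fintype.card A ≤ 2 * addOrderOf g := by
  by_cases hnc : ((univ.filter fun a : A => ρ a ∈ S).card = (univ.filter fun a : A => τ a ∈ S).card ∧
      (univ.filter fun a : A => ρ a ∈ T).card = (univ.filter fun a : A => τ a ∈ T).card ∧
      (univ.filter fun a : A => ρ a ∈ U).card = (univ.filter fun a : A => τ a ∈ U).card)
  · obtain ⟨hS', hT', hU'⟩ := hnc
    have cT := card_eq_parts' hρ hτ hne hsurj T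
    have hT₀ : (univ.filter fun a : A => ρ a ∈ T).card = 2 := by omega
    have hT₁ : (univ.filter fun a : A => τ a ∈ T).card = 2 := by omega
    obtain ⟨b₁, b₂, h12, e₀⟩ := card_eq_two.1 hT₀
    obtain ⟨b₃, b₄, h34, e₁⟩ := card_eq_two.1 hT₁
    obtain ⟨g, hg⟩ := cyclic_of_law_cube_two_pair hρρ hρτ hτρ hττ hρ hτ hne hsurj h h12 h34 e₀ e₁ hS' hU' hV
    exact ⟨g, by rw [card_eq_addOrderOf_of_zmultiples_eq_top hg]; omega⟩
  · obtain ⟨g, a, b, hab⟩ := two_cosets_of_mod_one_law_of_not_cube hρρ hρτ hτρ hττ hρ hτ hne hsurj hmod hA h hV hnc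
    exact ⟨g, card_le_two_mul_addOrderOf_of_two_cosets hab⟩

/-- **At `|A| = 25` every law triple forces an element of order `≥ 13`, i.e. `A` cyclic.** [folklore] -/
theorem card_le_two_mul_addOrderOf_of_law_card_25
    (hρρ : ∀ a b, ρ a * ρ b = ρ (a + b)) (hρτ : ∀ a b, ρ a * τ b = τ (b - a))
    (hτρ : ∀ a b, τ a * ρ b = τ (a + b)) (hττ : ∀ a b, τ a * τ b = ρ (c₀ + b - a))
    (hρ : Function.Injective ρ) (hτ : Function.Injective τ) (hne : ∀ a b, ρ a ≠ τ b)
    (hsurj : ∀ g, (∃ a, ρ a = g) ∨ (∃ a, τ a = g)) (hA : Fintype.card A = 25)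
    (h : TripleProductProperty S T U) (hV : 3 * (S.card * T.card * U.card) + 8 = 8 * Fintype.card A) :
    ∃ g : A, Fintype.card A ≤ 2 * addOrderOf g := by
  have hmod : Fintype.card A % 3 = 1 := by rw [hA]
  have hA14 : 14 ≤ Fintype.card A := by rw [hA]; norm_num
  have hA7 : 7 ≤ Fintype.card A := by omega
  -- the law in the role orders used below
  have hV_TUS : 3 * (T.card * U.card * S.card) + 8 = 8 * Fintype.card A := by
    rw [show T.card * U.card * S.card = S.card * T.card * U.card by ring]; exact hV
  have hV_UST : 3 * (U.card * S.card * T.card) + 8 = 8 * Fintype.card A := by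
    rw [show U.card * S.card * T.card = S.card * T.card * U.card by ring]; exact hV
  have hTUS : TripleProductProperty T U S := h.rotate
  have hUST : TripleProductProperty U S T := h.rotate.rotate
  by_cases hnc : ((univ.filter fun a : A => ρ a ∈ S).card = (univ.filter fun a : A => τ a ∈ S).card ∧
      (univ.filter fun a : A => ρ a ∈ T).card = (univ.filter fun a : A => τ a ∈ T).card ∧
      (univ.filter fun a : A => ρ a ∈ U).card = (univ.filter fun a : A => τ a ∈ U).card)
  · obtain ⟨hS', hT', hU'⟩ := hnc
    have cS := card_eq_parts' hρ hτ hne hsurj S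
    have cT := card_eq_parts' hρ hτ hne hsurj T
    have cU := card_eq_parts' hρ hτ hne hsurj U
    set s₀ := (univ.filter fun a : A => ρ a ∈ S).card with hs₀
    set t₀ := (univ.filter fun a : A => ρ a ∈ T).card with ht₀
    set u₀ := (univ.filter fun a : A => ρ a ∈ U).card with hu₀
    rw [cS, cT, cU, ← hS', ← hT', ← hU', hA] at hV
    have h8 : s₀ * t₀ * u₀ = 8 := by nlinarith
    have hs8 : s₀ ≤ 8 := Nat.le_of_dvd (by norm_num) ⟨t₀ * u₀, by rw [← h8]; ring⟩
    have ht8 : t₀ ≤ 8 := Nat.le_of_dvd (by norm_num) ⟨s₀ * u₀, by rw [← h8]; ring⟩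
    have key : t₀ = 2 ∨ s₀ = 2 ∨ u₀ = 2 ∨ (s₀ = 1 ∧ t₀ = 1) ∨ (t₀ = 1 ∧ u₀ = 1) ∨ (s₀ = 1 ∧ u₀ = 1) := by
      interval_cases s₀ <;> interval_cases t₀ <;> omega
    have eS : S.card = 2 * s₀ := by rw [cS, ← hS']; ring
    have eT : T.card = 2 * t₀ := by rw [cT, ← hT']; ring
    have eU : U.card = 2 * u₀ := by rw [cU, ← hU']; ring
    have hV' : 3 * (S.card * T.card * U.card) + 8 = 8 * Fintype.card A := by
      rw [eS, eT, eU, hA]; nlinarith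
    rcases key with h2 | h2 | h2 | ⟨h1, h1'⟩ | ⟨h1, h1'⟩ | ⟨h1, h1'⟩
    · exact card_le_two_mul_addOrderOf_of_mod_one_law_card_four hρρ hρτ hτρ hττ hρ hτ hne hsurj hmod hA14 h hV'
        (by rw [eT, h2])
    · exact card_le_two_mul_addOrderOf_of_mod_one_law_card_four hρρ hρτ hτρ hττ hρ hτ hne hsurj hmod hA14 hUST
        (by rw [show U.card * S.card * T.card = S.card * T.card * U.card by ring]; exact hV') (by rw [eS, h2])
    · exact card_le_two_mul_addOrderOf_of_mod_one_law_card_four hρρ hρτ hτρ hττ hρ hτ hne hsurj hmod hA14 hTUS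
        (by rw [show T.card * U.card * S.card = S.card * T.card * U.card by ring]; exact hV') (by rw [eU, h2])
    · exact card_le_two_mul_addOrderOf_of_two_two_law hρρ hρτ hτρ hττ hρ hτ hne hsurj hmod hA7 h
        (by rw [eS, h1]) (by rw [eT, h1']) hV'
    · exact card_le_two_mul_addOrderOf_of_two_two_law hρρ hρτ hτρ hττ hρ hτ hne hsurj hmod hA7 hTUS
        (by rw [eT, h1]) (by rw [eU, h1'])
        (by rw [show T.card * U.card * S.card = S.card * T.card * U.card by ring]; exact hV')
    · exact card_le_two_mul_addOrderOf_of_two_two_law hρρ hρτ hτρ hττ hρ hτ hne hsurj hmod hA7 hUST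
        (by rw [eU, h1']) (by rw [eS, h1])
        (by rw [show U.card * S.card * T.card = S.card * T.card * U.card by ring]; exact hV')
  · obtain ⟨g, a, b, hab⟩ :=
      two_cosets_of_mod_one_law_of_not_cube hρρ hρτ hτρ hττ hρ hτ hne hsurj hmod hA14 h hV hnc
    exact ⟨g, card_le_two_mul_addOrderOf_of_two_cosets hab⟩

/-- **No dihedral-like group of order 50 over `ℤ₅ × ℤ₅` (or any `A` of order 25 with all element orders `≤ 12`)
attains the law `64`.** [folklore] -/
theorem no_law_card_25_of_small_orders
    (hρρ : ∀ a b, ρ a * ρ b = ρ (a + b)) (hρτ : ∀ a b, ρ a * τ b = τ (b - a))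
    (hτρ : ∀ a b, τ a * ρ b = τ (a + b)) (hττ : ∀ a b, τ a * τ b = ρ (c₀ + b - a))
    (hρ : Function.Injective ρ) (hτ : Function.Injective τ) (hne : ∀ a b, ρ a ≠ τ b)
    (hsurj : ∀ g, (∃ a, ρ a = g) ∨ (∃ a, τ a = g)) (hA : Fintype.card A = 25)
    (hord : ∀ g : A, 2 * addOrderOf g < Fintype.card A) (h : TripleProductProperty S T U) :
    3 * (S.card * T.card * U.card) + 8 ≠ 8 * Fintype.card A := by
  intro hV
  obtain ⟨g, hg⟩ := card_le_two_mul_addOrderOf_of_law_card_25 hρρ hρτ hτρ hττ hρ hτ hne hsurj hA h hV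
  exact absurd (hord g) (not_lt.2 hg)

/-- **At `|A| = 6p + 1` (`p ≥ 3` prime) every law triple forces an element of order `≥ |A|/2`.**  The cube shapes
there have `s₀ t₀ u₀ = 2p`: a part `2` (a set of size 4) or two parts `1` (two sets of size 2). [folklore] -/
theorem card_le_two_mul_addOrderOf_of_law_card_six_prime_add_one
    (hρρ : ∀ a b, ρ a * ρ b = ρ (a + b)) (hρτ : ∀ a b, ρ a * τ b = τ (b - a))
    (hτρ : ∀ a b, τ a * ρ b = τ (a + b)) (hττ : ∀ a b, τ a * τ b = ρ (c₀ + b - a))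
    (hρ : Function.Injective ρ) (hτ : Function.Injective τ) (hne : ∀ a b, ρ a ≠ τ b)
    (hsurj : ∀ g, (∃ a, ρ a = g) ∨ (∃ a, τ a = g)) {p : ℕ} (hp : p.Prime) (h3 : 3 ≤ p)
    (hA : Fintype.card A = 6 * p + 1)
    (h : TripleProductProperty S T U) (hV : 3 * (S.card * T.card * U.card) + 8 = 8 * Fintype.card A) :
    ∃ g : A, Fintype.card A ≤ 2 * addOrderOf g := by
  have hmod : Fintype.card A % 3 = 1 := by rw [hA]; omega
  have hA14 : 14 ≤ Fintype.card A := by rw [hA]; omega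
  have hA7 : 7 ≤ Fintype.card A := by omega
  have hTUS : TripleProductProperty T U S := h.rotate
  have hUST : TripleProductProperty U S T := h.rotate.rotate
  by_cases hnc : ((univ.filter fun a : A => ρ a ∈ S).card = (univ.filter fun a : A => τ a ∈ S).card ∧
      (univ.filter fun a : A => ρ a ∈ T).card = (univ.filter fun a : A => τ a ∈ T).card ∧
      (univ.filter fun a : A => ρ a ∈ U).card = (univ.filter fun a : A => τ a ∈ U).card)
  · obtain ⟨hS', hT', hU'⟩ := hnc
    have cS := card_eq_parts' hρ hτ hne hsurj S
    have cT := card_eq_parts' hρ hτ hne hsurj T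
    have cU := card_eq_parts' hρ hτ hne hsurj U
    set s₀ := (univ.filter fun a : A => ρ a ∈ S).card with hs₀
    set t₀ := (univ.filter fun a : A => ρ a ∈ T).card with ht₀
    set u₀ := (univ.filter fun a : A => ρ a ∈ U).card with hu₀
    have eS : S.card = 2 * s₀ := by rw [cS, ← hS']; ring
    have eT : T.card = 2 * t₀ := by rw [cT, ← hT']; ring
    have eU : U.card = 2 * u₀ := by rw [cU, ← hU']; ring
    have hV' := hV
    rw [eS, eT, eU, hA] at hV
    have h8 : s₀ * t₀ * u₀ = 2 * p := by ring_nf at hV; omega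
    -- `p` divides one of the parts; the other two multiply (with the cofactor) to `2`
    have key : t₀ = 2 ∨ s₀ = 2 ∨ u₀ = 2 ∨ (s₀ = 1 ∧ t₀ = 1) ∨ (t₀ = 1 ∧ u₀ = 1) ∨ (s₀ = 1 ∧ u₀ = 1) := by
      have hdvd : p ∣ s₀ * t₀ * u₀ := ⟨2, by rw [h8]; ring⟩
      rcases (Nat.Prime.dvd_mul hp).1 hdvd with h12 | hu
      · rcases (Nat.Prime.dvd_mul hp).1 h12 with hs | ht
        · obtain ⟨k, hk⟩ := hs
          have e : k * t₀ * u₀ = 2 := by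
            have h' : (k * t₀ * u₀) * p = 2 * p := by
              calc (k * t₀ * u₀) * p = s₀ * t₀ * u₀ := by rw [hk]; ring
                _ = 2 * p := h8
            exact Nat.eq_of_mul_eq_mul_right hp.pos h'
          have ht2 : t₀ ≤ 2 := Nat.le_of_dvd (by norm_num) ⟨k * u₀, by rw [← e]; ring⟩
          have hu2 : u₀ ≤ 2 := Nat.le_of_dvd (by norm_num) ⟨k * t₀, by rw [← e]; ring⟩
          interval_cases t₀ <;> interval_cases u₀ <;> omega
        · obtain ⟨k, hk⟩ := ht
          have e : s₀ * k * u₀ = 2 := by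
            have h' : (s₀ * k * u₀) * p = 2 * p := by
              calc (s₀ * k * u₀) * p = s₀ * t₀ * u₀ := by rw [hk]; ring
                _ = 2 * p := h8
            exact Nat.eq_of_mul_eq_mul_right hp.pos h'
          have hs2 : s₀ ≤ 2 := Nat.le_of_dvd (by norm_num) ⟨k * u₀, by rw [← e]; ring⟩
          have hu2 : u₀ ≤ 2 := Nat.le_of_dvd (by norm_num) ⟨s₀ * k, by rw [← e]; ring⟩
          interval_cases s₀ <;> interval_cases u₀ <;> omega
      · obtain ⟨k, hk⟩ := hu
        have e : s₀ * t₀ * k = 2 := by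
          have h' : (s₀ * t₀ * k) * p = 2 * p := by
            calc (s₀ * t₀ * k) * p = s₀ * t₀ * u₀ := by rw [hk]; ring
              _ = 2 * p := h8
          exact Nat.eq_of_mul_eq_mul_right hp.pos h'
        have hs2 : s₀ ≤ 2 := Nat.le_of_dvd (by norm_num) ⟨t₀ * k, by rw [← e]; ring⟩
        have ht2 : t₀ ≤ 2 := Nat.le_of_dvd (by norm_num) ⟨s₀ * k, by rw [← e]; ring⟩
        interval_cases s₀ <;> interval_cases t₀ <;> omega
    rcases key with h2 | h2 | h2 | ⟨h1, h1'⟩ | ⟨h1, h1'⟩ | ⟨h1, h1'⟩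
    · exact card_le_two_mul_addOrderOf_of_mod_one_law_card_four hρρ hρτ hτρ hττ hρ hτ hne hsurj hmod hA14 h hV'
        (by rw [eT, h2])
    · exact card_le_two_mul_addOrderOf_of_mod_one_law_card_four hρρ hρτ hτρ hττ hρ hτ hne hsurj hmod hA14 hUST
        (by rw [show U.card * S.card * T.card = S.card * T.card * U.card by ring]; exact hV') (by rw [eS, h2])
    · exact card_le_two_mul_addOrderOf_of_mod_one_law_card_four hρρ hρτ hτρ hττ hρ hτ hne hsurj hmod hA14 hTUS
        (by rw [show T.card * U.card * S.card = S.card * T.card * U.card by ring]; exact hV') (by rw [eU, h2])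
    · exact card_le_two_mul_addOrderOf_of_two_two_law hρρ hρτ hτρ hττ hρ hτ hne hsurj hmod hA7 h
        (by rw [eS, h1]) (by rw [eT, h1']) hV'
    · exact card_le_two_mul_addOrderOf_of_two_two_law hρρ hρτ hτρ hττ hρ hτ hne hsurj hmod hA7 hTUS
        (by rw [eT, h1]) (by rw [eU, h1'])
        (by rw [show T.card * U.card * S.card = S.card * T.card * U.card by ring]; exact hV')
    · exact card_le_two_mul_addOrderOf_of_two_two_law hρρ hρτ hτρ hττ hρ hτ hne hsurj hmod hA7 hUST
        (by rw [eU, h1']) (by rw [eS, h1])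
        (by rw [show U.card * S.card * T.card = S.card * T.card * U.card by ring]; exact hV')
  · obtain ⟨g, a, b, hab⟩ :=
      two_cosets_of_mod_one_law_of_not_cube hρρ hρτ hτρ hττ hρ hτ hne hsurj hmod hA14 h hV hnc
    exact ⟨g, card_le_two_mul_addOrderOf_of_two_cosets hab⟩

/-- **No law over `A` of order `6p + 1` (`p ≥ 3` prime) with all element orders `< |A|/2`** — e.g. no
non-cyclic `A` of such an order carries a dihedral-like group attaining `3|S||T||U| + 8 = 8|A|`. [folklore] -/
theorem no_law_card_six_prime_add_one_of_small_orders
    (hρρ : ∀ a b, ρ a * ρ b = ρ (a + b)) (hρτ : ∀ a b, ρ a * τ b = τ (b - a))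
    (hτρ : ∀ a b, τ a * ρ b = τ (a + b)) (hττ : ∀ a b, τ a * τ b = ρ (c₀ + b - a))
    (hρ : Function.Injective ρ) (hτ : Function.Injective τ) (hne : ∀ a b, ρ a ≠ τ b)
    (hsurj : ∀ g, (∃ a, ρ a = g) ∨ (∃ a, τ a = g)) {p : ℕ} (hp : p.Prime) (h3 : 3 ≤ p)
    (hA : Fintype.card A = 6 * p + 1) (hord : ∀ g : A, 2 * addOrderOf g < Fintype.card A)
    (h : TripleProductProperty S T U) :
    3 * (S.card * T.card * U.card) + 8 ≠ 8 * Fintype.card A := by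
  intro hV
  obtain ⟨g, hg⟩ :=
    card_le_two_mul_addOrderOf_of_law_card_six_prime_add_one hρρ hρτ hτρ hττ hρ hτ hne hsurj hp h3 hA h hV
  exact absurd (hord g) (not_lt.2 hg)

/-- **Ceiling `law − 2` at `|A| = 25` over small-order `A`**: every TPP triple has `3|S||T||U| + 14 ≤ 8|A|`, i.e.
`β ≤ 62` for dihedral-like groups of order 50 over `ℤ₅ × ℤ₅` (census datum: `β(Dih(ℤ₅²)) = 60`). [folklore] -/
theorem tpp_volume_le_law_sub_two_of_small_orders_card_25
    (hρρ : ∀ a b, ρ a * ρ b = ρ (a + b)) (hρτ : ∀ a b, ρ a * τ b = τ (b - a))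
    (hτρ : ∀ a b, τ a * ρ b = τ (a + b)) (hττ : ∀ a b, τ a * τ b = ρ (c₀ + b - a))
    (hρ : Function.Injective ρ) (hτ : Function.Injective τ) (hne : ∀ a b, ρ a ≠ τ b)
    (hsurj : ∀ g, (∃ a, ρ a = g) ∨ (∃ a, τ a = g)) (hA : Fintype.card A = 25)
    (hord : ∀ g : A, 2 * addOrderOf g < Fintype.card A) (h : TripleProductProperty S T U) :
    3 * (S.card * T.card * U.card) + 14 ≤ 8 * Fintype.card A := by
  rcases tpp_volume_mod_one_gap hρρ hρτ hτρ hττ hρ hτ hne hsurj (by rw [hA]) (by rw [hA]; norm_num) h with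
    hlaw | hle
  · exact absurd hlaw (no_law_card_25_of_small_orders hρρ hρτ hτρ hττ hρ hτ hne hsurj hA hord h)
  · exact hle

/-- **Ceiling `law − 2` at `|A| = 6p + 1` (`p ≥ 3` prime) over small-order `A`**: `3|S||T||U| + 14 ≤ 8|A|`.
[folklore] -/
theorem tpp_volume_le_law_sub_two_of_small_orders_card_six_prime_add_one
    (hρρ : ∀ a b, ρ a * ρ b = ρ (a + b)) (hρτ : ∀ a b, ρ a * τ b = τ (b - a))
    (hτρ : ∀ a b, τ a * ρ b = τ (a + b)) (hττ : ∀ a b, τ a * τ b = ρ (c₀ + b - a))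
    (hρ : Function.Injective ρ) (hτ : Function.Injective τ) (hne : ∀ a b, ρ a ≠ τ b)
    (hsurj : ∀ g, (∃ a, ρ a = g) ∨ (∃ a, τ a = g)) {p : ℕ} (hp : p.Prime) (h3 : 3 ≤ p)
    (hA : Fintype.card A = 6 * p + 1) (hord : ∀ g : A, 2 * addOrderOf g < Fintype.card A)
    (h : TripleProductProperty S T U) :
    3 * (S.card * T.card * U.card) + 14 ≤ 8 * Fintype.card A := by
  rcases tpp_volume_mod_one_gap hρρ hρτ hτρ hττ hρ hτ hne hsurj (by rw [hA]; omega) (by rw [hA]; omega) h with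
    hlaw | hle
  · exact absurd hlaw (no_law_card_six_prime_add_one_of_small_orders hρρ hρτ hτρ hττ hρ hτ hne hsurj hp h3 hA
      hord h)
  · exact hle

end DihedralLike

end Summit.MatrixMultiplication.OmegaCensus
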